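import Literature.MathematicalPhysics.QuantumFieldTheory.Balaban1983to89.B9SupplySockB9P3ZdAllLettersZd
import Literature.MathematicalPhysics.QuantumFieldTheory.Balaban1983to89.B8CubeMemberLevelSep
import Literature.MathematicalPhysics.QuantumFieldTheory.Balaban1983to89.B8Ineq159CurvedCubeMemberLocalTower
import Literature.MathematicalPhysics.QuantumFieldTheory.Balaban1983to89.B9Eq327GreenZdHerm
import Literature.MathematicalPhysics.QuantumFieldTheory.Balaban1983to89.B9Eq316AveragingTransposeZdLevelZero

/-!
# `Balaban1983to89.B9Eq326DeltaALocalityZd` — [Balaban1985BackgroundPropagators] (3.26)–(3.27) p. 395 at the `ℤᵈ × 𝔸` carrier: THE GENUINE FOUR-LETTER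
# `Δ_a(U₀)↾Ω₀ = Ω₀(D*D + Δ′ + DRD* + Q*aQ)Ω₀` READS THE BACKGROUND NEAR `Ω₀` ONLY — per-letter locality in `U₀` of dag-n06-w4's record `opsAllZd`
# (`D*D`: [Balaban1985RegularSpaces] (1.55); `Δ′`: (3.10); `D R(U₀) 𝟙 D*`: (3.20)–(3.25) with `Q′_j(U₀)` of (3.19); `Q*aQ`: (3.16) with its (1.7) guard),
# hence of `RegularAt ∕ RegularAtH ∕ HermPreservingAt`; at the cube member agreement on the box `□₀ ± 3` suffices

statement-level skeleton of published theorems with citation tags; proofs where landed; nothing here is a claim about the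
Yang–Mills mass gap

`[Balaban1985Averaging]` ("B7" = B9's [5], CMP **98** (1985) 17–51) p. 24: «Let us notice that this definition is local in the sense that Ū^k_c, c ⊂ Ω^{(k)},
depends only on the bond variables U_b for b ⊂ B^k(c₋) ∪ B^k(c₊). This property will play a very important role in the future.»; (78)–(80) p. 30 (the
level transporters).  `[Balaban1985BackgroundPropagators]` ("B9") (3.10) p. 392, (3.16) p. 393, (3.19) p. 393, (3.20)–(3.27) pp. 394–395, (3.69) p. 404
(«the supremum … is taken over bonds belonging to one of the plaquettes containing the bond b»).  `[Balaban1985RegularSpaces]` ("B8") (1.7) p. 77,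
(1.31) p. 82, (1.55) p. 86, (1.131) p. 99.

CITATION HEADER (lean-in-tree rule).  Cell `pub-ymgap` (YM-PLAN Track A, HUMAN RULING D-0062), DAG node N06 = [B9], seat `pub-ymgap-dag-n06-b`
generation 19 (CLAIM-2 «IDEA-3.11 (iv)» 2026-08-28T05:34Z; INTENT-3).

WHY THIS FILE.  The gauge step of [B9] Thm 3.11's proof at one member (`B9Thm311GaugeReductionZd.of_pdevOn_lt`, this seat) turns «regular on a uniform
ball around the flat background» (dag-n06-w4 g3 `B9Thm311PosDefNearFlatZd` + dag-n06-w2 g3 `B9Eq17RegimeBallZd`) and «regularity passes along gauge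
orbits» (dag-n06-w3 g3 `B9Eq334GaugeCovarianceZd[Herm]`) into «regular at EVERY unitary background with small plaquettes on a box around the member»
— PROVIDED the property reads the background on that box only (hypothesis (L)).  THIS FILE proves (L) for `P := RegularAtH i.η (opsAllZd …) (i.Ω 0)`
(and `RegularAt`, `HermPreservingAt`): the genuine `Δ_a(U₀)` evaluated on `E(Ω₀)` at the bonds of `Ω₀` depends on `U₀` only through the bonds near
`Ω₀`, letter by letter — `D*D` and `Δ′` through the plaquettes through the bond, `D R(U₀) 𝟙_{Ω₀} D*` through the unit balls of the `Ω₀`-sites and the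
fine block towers under the `Λ_j`-sites (where `Q′_j(U₀)` of `N_𝔤(Q′(U₀))` averages), `Q*aQ` through its (1.7) guard (plaquettes touching the `Ω_j`) and
the boxes of the class bonds of level `j ≥ 1` (EDITION P₀'s law; level `0` reads nothing).  At a cube member all of these lie in `□₀ ± 3` (§5).  Everything
is assembled from landed locality lemmas BY NAME: dag-n05-w3's `Jcur_congr_bg ∕ covLap_congr_bg ∕ covDivB_congr_bg ∕ covDerivFwd_congr_bg ∕ bgT_congr_bg`
(`B8Ineq159CurvedCubeMemberLocal[Tower]`), this lineage's `B9Ineq3137LocalSup.linCovIter_congr`, b9-g1x's `divL_congr_local` device read for the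
background; no letter is restated.

WHAT IS PROVED (kernel, 0 sorry, 0 def).
* §1 (3.10): `plaqU_congr_bg` · `letters_congr_bg` (the five plaquette letter functions `F^J, G₁, …, G₄` read the four bonds of their plaquette) · `divL_congr_bg` ·
  ★ `deltaPrimeOp_congr_bg` (abstract lattice) · ★ `DpZd_congr_bg` (`Δ′(U₀)` at `⟨x, x+e_μ⟩` reads `U₀` on the ℓ∞-unit ball of `x`).
* §2 (3.19)–(3.25): ★ `QprimeIter_bgT_congr_bg` (`(Q′_j(U₀)λ)(y)` reads the fine `Lʲ`-block under `y`; induction on `j` through `bgT_congr_bg`) ·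
  `gaugeNull_congr_bg` · `rangeGen_congr_bg` · `rangeSub_congr_bg` · ★ `projE_congr_bg` ∕ `projR_congr_bg` (the projection `R(U₀)` of (3.21)–(3.22)) ·
  `projR_congr_fun` · ★★ `opsLandau_DRDs_congr_bg` (the genuine `D R(U₀) 𝟙_{Ω₀} D*` at a member with finite `Ω₀`).
* §3 (3.16): `plaqF_congr_bg` · ★ `reg17_congr_bg` (the (1.7) guard) · `clsField_congr_bg` · `linCovIterT_clsField_congr_bg` · ★★ `QQZdP_congr_bg` (box clause at
  levels `j ≥ 1` only — print's class included).
* §4 ★★ `deltaAOf_opsAllZd_congr_bg` (the four letters at once, finite `Ω₀`) · `deltaADom_congr_of_bonds` · `regularAt_congr_of_deltaADom` ·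
  `regularAtH_congr_of_deltaADom` · `hermPreservingAt_congr_of_bonds` · `bondPair_deltaAOf_congr_of_bonds` (any record) · ★★★ `regular_opsAllZd_congr_of_key` ∕
  `regular_opsAllZd_congr_bg` (`RegularAtH`, `RegularAt`, `HermPreservingAt` and the form `⟨A, Δ_a(U₀)A⟩_τ` on `E(Ω₀)` transfer).
* §5 ★★★ `regular_opsAllZd_congr_cube` — at a cube member (`Ω = cubeFam false …`, `Λs = cubeLamS …`, class `cubeLamBP`, `m ≤ k`, `2 ≤ L ≤ ρ`): backgrounds
  agreeing on the bonds of `[sqLo₀ − 3·𝟙, sqHi₀ + 3·𝟙]` have the same `RegularAtH ∕ RegularAt ∕ HermPreservingAt` and the same forms `⟨A, Δ_a(·)A⟩_τ`,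
  `A ∈ E(□₀)` — hypothesis (L) of the gauge step, for regularity AND for positivity.

HONEST SCOPE.  Lattice bookkeeping (which bonds each landed letter reads); no estimate; nothing of [B9] Thm 3.3 ∕ 3.11's uniformity; count-neutral helper
of K1⁷ (`--supports stmt-QuantumFields-20542`); N05∕N06 NOT discharged; one finite `𝕋⁴` programme at fixed `ε`, Bałaban as printed; R4 closes only the
conditional finite-`𝕋⁴` rung `BalabanLadder.UV` — nothing continuum ∕ `ℝ⁴` ∕ OS ∕ mass gap ∕ Clay.  Unit `pub-ymgap-dag-n06-b` (g19), 2026-08-28.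
-/

noncomputable section

open scoped BigOperators
open NormedSpace Complex

namespace Literature.MathematicalPhysics.QuantumFieldTheory.Balaban1983to89.B9Eq326DeltaALocalityZd

export B7Prop1Explicit (Site)

/-! ## §1 The curvature letter `Δ′(U₀)` of (3.10) reads the background on the plaquettes through the bond -/

section DeltaPrime

open Literature.MathematicalPhysics.QuantumFieldTheory.Balaban1983to89.B9Eq37Insertion
open Literature.MathematicalPhysics.QuantumFieldTheory.Balaban1983to89.B9Eq39Adjoint
open Literature.MathematicalPhysics.QuantumFieldTheory.Balaban1983to89.B9Eq310Hermitian
open B9Eq369Small (Through)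

variable {𝔸 : Type*} [Ring 𝔸] [Algebra ℂ 𝔸] {S : Type*} {ι : Type*} (T : ι → Equiv.Perm S) {U U' : ι → S → 𝔸ˣ}

omit [Algebra ℂ 𝔸] in
/-- the plaquette variable `U(∂p)` of `p = p_{μν}(x)` reads the background on the four bonds of `∂p`. [cite: Balaban1985BackgroundPropagators, (3.1) p.390] -/
theorem plaqU_congr_bg {μ ν : ι} {x : S} (h1 : U μ x = U' μ x) (h2 : U ν (T μ x) = U' ν (T μ x))
    (h3 : U μ (T ν x) = U' μ (T ν x)) (h4 : U ν x = U' ν x) : plaqU T U μ ν x = plaqU T U' μ ν x := by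
  unfold plaqU; rw [h1, h2, h3, h4]

/-- the five plaquette letter functions of (3.10) (`F^J`, `G₁`, …, `G₄`) at `p = p_{κν}(y)` read the background on the four bonds of `∂p`.
[cite: Balaban1985BackgroundPropagators, (3.10) p.392] -/
theorem letters_congr_bg (η : ℝ) (A : ι → S → 𝔸) {κ ν : ι} {y : S} (h1 : U κ y = U' κ y) (h2 : U ν (T κ y) = U' ν (T κ y))
    (h3 : U κ (T ν y) = U' κ (T ν y)) (h4 : U ν y = U' ν y) :
    jordanF T U η A κ ν y = jordanF T U' η A κ ν y ∧ commG₁ T U η A κ ν y = commG₁ T U' η A κ ν y ∧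
      commG₂ T U η A κ ν y = commG₂ T U' η A κ ν y ∧ commG₃ T U η A κ ν y = commG₃ T U' η A κ ν y ∧
      commG₄ T U η A κ ν y = commG₄ T U' η A κ ν y := by
  have hp : plaqU T U κ ν y = plaqU T U' κ ν y := plaqU_congr_bg T h1 h2 h3 h4
  refine ⟨?_, ?_, ?_, ?_, ?_⟩ <;>
    simp only [jordanF, commG₁, commG₂, commG₃, commG₄, zP, yP, curl, covD, sgnSum₁, sgnSum₂, sgnSum₃, sgnSum₄, hp, h1, h4]

variable [Fintype ι] [LinearOrder ι]

omit [Algebra ℂ 𝔸] in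
/-- the letter divergence `÷` at the bond `b = ⟨x, x+e_μ⟩` reads the background's own conjugations at the bonds `(ν, x − e_ν)`. [cite: Balaban1985BackgroundPropagators, (3.9) p.392] -/
theorem divL_congr_bg (G₁ G₂ G₃ G₄ : ι → ι → S → 𝔸) (μ : ι) (x : S) (h : ∀ ν, U ν ((T ν).symm x) = U' ν ((T ν).symm x)) :
    divL T U G₁ G₂ G₃ G₄ μ x = divL T U' G₁ G₂ G₃ G₄ μ x := by
  unfold divL
  congr 1
  · exact Finset.sum_congr rfl fun ν _ => by rw [h ν]
  · exact Finset.sum_congr rfl fun ν _ => by rw [h ν]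

/-- ★ **`Δ′` READS THE BACKGROUND ON THE PLAQUETTES THROUGH THE BOND** (and at the base conjugations `(ν, x − e_ν)`): if `U` and `U′` agree on the four
bonds of every plaquette through `b = ⟨x, x + e_μ⟩` and at the bonds `(ν, T_ν⁻¹x)`, then `(Δ′(U)A)(b) = (Δ′(U′)A)(b)`.
[cite: Balaban1985BackgroundPropagators, (3.10) p.392, (3.69) p.404 («bonds belonging to one of the plaquettes containing the bond b»)] -/
theorem deltaPrimeOp_congr_bg (η : ℝ) (A : ι → S → 𝔸) (μ : ι) (x : S) (hx : ∀ ν, U ν ((T ν).symm x) = U' ν ((T ν).symm x))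
    (hpl : ∀ κ ν y, Through T μ x κ ν y →
      U κ y = U' κ y ∧ U ν (T κ y) = U' ν (T κ y) ∧ U κ (T ν y) = U' κ (T ν y) ∧ U ν y = U' ν y) :
    deltaPrimeOp T U η A μ x = deltaPrimeOp T U' η A μ x := by
  have hJ : ∀ κ ν y, Through T μ x κ ν y → jordanF T U η A κ ν y = jordanF T U' η A κ ν y ∧
      jordanF T U η A κ ν y = jordanF T U' η A κ ν y ∧ jordanF T U η A κ ν y = jordanF T U' η A κ ν y ∧
      jordanF T U η A κ ν y = jordanF T U' η A κ ν y := by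
    intro κ ν y h
    obtain ⟨h1, h2, h3, h4⟩ := hpl κ ν y h
    have e := (letters_congr_bg T η A h1 h2 h3 h4).1
    exact ⟨e, e, e, e⟩
  have hG : ∀ κ ν y, Through T μ x κ ν y → commG₁ T U η A κ ν y = commG₁ T U' η A κ ν y ∧
      commG₂ T U η A κ ν y = commG₂ T U' η A κ ν y ∧ commG₃ T U η A κ ν y = commG₃ T U' η A κ ν y ∧
      commG₄ T U η A κ ν y = commG₄ T U' η A κ ν y := by
    intro κ ν y h
    obtain ⟨h1, h2, h3, h4⟩ := hpl κ ν y h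
    exact (letters_congr_bg T η A h1 h2 h3 h4).2
  unfold deltaPrimeOp
  rw [← divL_self, ← divL_self, B9Eq369Small.divL_congr_local T U μ x hJ, B9Eq369Small.divL_congr_local T U μ x hG,
    divL_congr_bg T _ _ _ _ μ x hx, divL_congr_bg T _ _ _ _ μ x hx]

end DeltaPrime

section DpZd

open B7Prop1Explicit (e)
open B8Eq133Hypotheses (shiftT byDir shiftT_apply byDir_apply)
open B9Eq369CurvSmallZd (DpZd shiftT_symm_apply)
open B9Eq369Small (Through)

variable {d : ℕ} {𝔸 : Type*} [CStarAlgebra 𝔸]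

/-- ★ **THE GENUINE `Δ′(U₀)` ON `ℤᵈ` READS THE BACKGROUND ON THE ℓ∞-UNIT BALL OF THE BOND's BASE**: if `U₀(y, κ) = U₀′(y, κ)` whenever `|y − x|∞ ≤ 1`,
then `(Δ′(U₀)A)(⟨x, x+e_μ⟩) = (Δ′(U₀′)A)(⟨x, x+e_μ⟩)`. [cite: Balaban1985BackgroundPropagators, (3.10) p.392, (3.69) p.404] -/
theorem DpZd_congr_bg (η : ℝ) {U₀ U₀' : Site d → Fin d → 𝔸ˣ} (A : Site d → Fin d → 𝔸) (x : Site d) (μ : Fin d)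
    (h : ∀ (y : Site d) (κ : Fin d), (∀ i, x i - 1 ≤ y i ∧ y i ≤ x i + 1) → U₀ y κ = U₀' y κ) :
    DpZd η U₀ A x μ = DpZd η U₀' A x μ := by
  have hx0 : ∀ κ, U₀ x κ = U₀' x κ := fun κ => h x κ fun i => ⟨by linarith, by linarith⟩
  have hm : ∀ ν κ, U₀ (x - e ν) κ = U₀' (x - e ν) κ := fun ν κ => h _ κ fun i => by
    rw [Pi.sub_apply, B7Prop1Explicit.e_apply]; split_ifs <;> constructor <;> linarith
  have hp : ∀ ν κ, U₀ (x + e ν) κ = U₀' (x + e ν) κ := fun ν κ => h _ κ fun i => by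
    rw [Pi.add_apply, B7Prop1Explicit.e_apply]; split_ifs <;> constructor <;> linarith
  have hmp : ∀ ν ν' κ, U₀ (x - e ν + e ν') κ = U₀' (x - e ν + e ν') κ := fun ν ν' κ => h _ κ fun i => by
    rw [Pi.add_apply, Pi.sub_apply, B7Prop1Explicit.e_apply, B7Prop1Explicit.e_apply]
    split_ifs <;> constructor <;> linarith
  unfold DpZd
  refine deltaPrimeOp_congr_bg (shiftT d) η (byDir A) μ x (fun ν => ?_) (fun κ ν y hy => ?_)
  · rw [shiftT_symm_apply]; exact hm ν ν
  · obtain ⟨-, hcase⟩ := hy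
    simp only [byDir_apply, shiftT_apply]
    rcases hcase with ⟨-, rfl | rfl⟩ | ⟨-, rfl | rfl⟩
    · exact ⟨hx0 κ, hp κ ν, hp ν κ, hx0 ν⟩
    · rw [shiftT_symm_apply]
      exact ⟨hm κ κ, hmp κ κ ν, hmp κ ν κ, hm κ ν⟩
    · exact ⟨hx0 κ, hp κ ν, hp ν κ, hx0 ν⟩
    · rw [shiftT_symm_apply]
      exact ⟨hm ν κ, hmp ν κ ν, hmp ν ν κ, hm ν ν⟩

end DpZd

/-! ## §2 The gauge-fixing letter `D R(U₀) 𝟙_{Ω₀} D*`: `Q′_j(U₀)` reads the block towers under the `Λ_j`-sites, `Δ^η_{U₀}` the unit ball of `Ω₀` -/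

section Landau

open Literature.MathematicalPhysics.QuantumLattice (blockSites blockBase blockMap blockMap_blockBase_add)
open B7Prop1Explicit (e)
open B7Prop1Local (InBox AgreeOn)
open B7Eq78Linearization (QprimeIter zdBlocking Qprime_apply QprimeIter_succ conjR)
open B8Eq119TwistedAxial (bgT)
open B8Eq138LandauZd (covLap covDivB)
open B8Ineq132 (covDerivFwd)
open B8Ineq159CurvedCubeMemberLocal (covLap_congr_bg covDivB_congr_bg covDerivFwd_congr_bg)
open B8Ineq159CurvedCubeMemberLocalTower (bgT_congr_bg)
open B8LeafModelZd (ZdIdx)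
open B9SupplySockB9P3ZdLetters (OpsZd)
open B9Eq321LandauProjectionZd (gaugeNull rangeGen rangeSub projE projR opsLandau opsLandau_DRDs_of_finite indicator_mem_suppSub)

variable {d : ℕ} {𝔸 : Type*} [CStarAlgebra 𝔸] {U₀ U₀' : Site d → Fin d → 𝔸ˣ}

omit [CStarAlgebra 𝔸] in
/-- a site of the `L`-block of `y` lies between `L·y` and `L·y + (L − 1)𝟙`. [folklore] -/
private theorem bounds_of_mem_blockSites {L : ℕ} {y x : Site d} (hx : x ∈ blockSites L y) :
    ∀ i, (L : ℤ) * y i ≤ x i ∧ x i ≤ (L : ℤ) * y i + ((L : ℤ) - 1) := by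
  simp only [blockSites, Finset.mem_image, Fintype.mem_piFinset, Finset.mem_range] at hx
  obtain ⟨t, ht, rfl⟩ := hx
  intro i
  have h := ht i
  simp only [blockBase, Pi.add_apply]
  constructor <;> omega

omit [CStarAlgebra 𝔸] in
/-- a site of the `L`-block of `y` has block index `y`. [folklore] -/
private theorem blockMap_of_mem_blockSites {L : ℕ} {y x : Site d} (hx : x ∈ blockSites L y) : blockMap L x = y := by
  simp only [blockSites, Finset.mem_image, Fintype.mem_piFinset, Finset.mem_range] at hx
  obtain ⟨t, ht, rfl⟩ := hx
  exact blockMap_blockBase_add L y t ht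

/-- ★ **`Q′_j(U₀)λ` AT A LEVEL-`j` SITE `y` READS THE BACKGROUND ON THE FINE `Lʲ`-BLOCK UNDER `y`** ([5] p. 24 locality of the averages, iterated
through (3.19)): backgrounds agreeing on `[Lʲy, Lʲy + (Lʲ − 1)𝟙]` have the same `(Q′_j(U₀)λ)(y)` for every `λ`. [cite: Balaban1985BackgroundPropagators, (3.19) p.393; Balaban1985Averaging, p.24 (after (43)), (78)–(80) p.30] -/
theorem QprimeIter_bgT_congr_bg {L : ℕ} (hL : 1 ≤ L) :
    ∀ (j : ℕ) (lam : Site d → 𝔸) (y : Site d),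
      AgreeOn (blockBase (L ^ j) y) (blockBase (L ^ j) y + (((L : ℤ) ^ j) - 1) • (1 : Site d)) U₀ U₀' →
      QprimeIter (zdBlocking d L) (bgT L U₀) j lam y = QprimeIter (zdBlocking d L) (bgT L U₀') j lam y
  | 0, _, _, _ => rfl
  | j + 1, lam, y, h => by
    rw [QprimeIter_succ, QprimeIter_succ, Qprime_apply, Qprime_apply]
    refine Finset.sum_congr rfl fun x hx => ?_
    change x ∈ blockSites L y at hx
    have hy : blockMap L x = y := blockMap_of_mem_blockSites hx
    have hb := bounds_of_mem_blockSites hx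
    have hLj : (0 : ℤ) ≤ (L : ℤ) ^ j := by positivity
    -- the transporter reads the fine `L^{j+1}`-block of `y`
    have h1 : bgT L U₀ j y x = bgT L U₀' j y x := by
      rw [← hy]
      refine bgT_congr_bg hL j x ?_
      rw [hy]; exact h
    -- the lower iterate at `x` reads the fine `Lʲ`-block of `x`, inside that of `y`
    have h2 : QprimeIter (zdBlocking d L) (bgT L U₀) j lam x = QprimeIter (zdBlocking d L) (bgT L U₀') j lam x := by
      refine QprimeIter_bgT_congr_bg hL j lam x (h.mono (fun i => ?_) (fun i => ?_))
      · have h1' := mul_le_mul_of_nonneg_left (hb i).1 hLj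
        have e1 : ((L : ℤ) ^ j) * ((L : ℤ) * y i) = ((L : ℤ) ^ j * L) * y i := by ring
        simp only [blockBase]
        push_cast
        rw [pow_succ]
        linarith
      · have h2' := mul_le_mul_of_nonneg_left (hb i).2 hLj
        have e2 : ((L : ℤ) ^ j) * ((L : ℤ) * y i + ((L : ℤ) - 1)) = ((L : ℤ) ^ j * L) * y i + (((L : ℤ) ^ j * L) - (L : ℤ) ^ j) := by ring
        simp only [blockBase, Pi.add_apply, Pi.smul_apply, Pi.one_apply, smul_eq_mul, mul_one]
        push_cast
        rw [pow_succ]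
        linarith
    show (zdBlocking d L).wt j y x • conjR (bgT L U₀ j y x) (QprimeIter (zdBlocking d L) (bgT L U₀) j lam x) =
      (zdBlocking d L).wt j y x • conjR (bgT L U₀' j y x) (QprimeIter (zdBlocking d L) (bgT L U₀') j lam x)
    rw [h1, h2]

variable (s : Finset (Site d)) (L m : ℕ) (η : ℝ) (Λs : ℕ → Set (Site d))

/-- **`N_𝔤(Q′(U₀))` READS THE BACKGROUND ON THE BLOCK TOWERS UNDER THE `Λ_j`-SITES.** [cite: Balaban1985BackgroundPropagators, (3.21) p.394, (3.19) p.393] -/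
theorem gaugeNull_congr_bg (hL : 1 ≤ L)
    (hΛ : ∀ j, j ≤ m → ∀ y ∈ Λs j, AgreeOn (blockBase (L ^ j) y) (blockBase (L ^ j) y + (((L : ℤ) ^ j) - 1) • (1 : Site d)) U₀ U₀') :
    gaugeNull s L m Λs U₀ = gaugeNull s L m Λs U₀' := by
  ext lam
  simp only [gaugeNull, Set.mem_setOf_eq]
  refine ⟨fun ⟨h1, h2, h3⟩ => ⟨h1, h2, fun j hj y hy => ?_⟩, fun ⟨h1, h2, h3⟩ => ⟨h1, h2, fun j hj y hy => ?_⟩⟩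
  · rw [← QprimeIter_bgT_congr_bg hL j lam y (hΛ j hj y hy)]; exact h3 j hj y hy
  · rw [QprimeIter_bgT_congr_bg hL j lam y (hΛ j hj y hy)]; exact h3 j hj y hy

/-- **THE GENERATORS `𝟙_{Ω₀}Δ^η_{U₀}λ` READ, IN ADDITION, THE UNIT BALL OF `Ω₀`.** [cite: Balaban1985BackgroundPropagators, (3.21) p.394, (3.23) p.394] -/
theorem rangeGen_congr_bg (hL : 1 ≤ L)
    (hΛ : ∀ j, j ≤ m → ∀ y ∈ Λs j, AgreeOn (blockBase (L ^ j) y) (blockBase (L ^ j) y + (((L : ℤ) ^ j) - 1) • (1 : Site d)) U₀ U₀')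
    (hs : ∀ x ∈ s, ∀ (y : Site d) (κ : Fin d), (∀ i, x i - 1 ≤ y i ∧ y i ≤ x i + 1) → U₀ y κ = U₀' y κ) :
    rangeGen s L m η Λs U₀ = rangeGen s L m η Λs U₀' := by
  have hind : ∀ lam : Site d → 𝔸, (↑s : Set (Site d)).indicator (covLap η U₀ lam) = (↑s : Set (Site d)).indicator (covLap η U₀' lam) := by
    intro lam
    funext x
    by_cases hx : x ∈ (↑s : Set (Site d))
    · rw [Set.indicator_of_mem hx, Set.indicator_of_mem hx]
      exact covLap_congr_bg lam x (hs x (Finset.mem_coe.mp hx))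
    · rw [Set.indicator_of_notMem hx, Set.indicator_of_notMem hx]
  ext w
  simp only [rangeGen, Set.mem_setOf_eq, gaugeNull_congr_bg s L m Λs hL hΛ, hind]

/-- **`R = Δ^η_{U₀}N_𝔤(Q′(U₀))` as a subspace of `L²(Ω₀, ·)` reads the background there only.** [cite: Balaban1985BackgroundPropagators, (3.21) p.394] -/
theorem rangeSub_congr_bg (hL : 1 ≤ L)
    (hΛ : ∀ j, j ≤ m → ∀ y ∈ Λs j, AgreeOn (blockBase (L ^ j) y) (blockBase (L ^ j) y + (((L : ℤ) ^ j) - 1) • (1 : Site d)) U₀ U₀')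
    (hs : ∀ x ∈ s, ∀ (y : Site d) (κ : Fin d), (∀ i, x i - 1 ≤ y i ∧ y i ≤ x i + 1) → U₀ y κ = U₀' y κ) :
    rangeSub s L m η Λs U₀ = rangeSub s L m η Λs U₀' := by
  unfold rangeSub
  rw [rangeGen_congr_bg s L m η Λs hL hΛ hs]

variable (τ : 𝔸 →ₗ[ℂ] ℂ)

/-- ★ **THE PROJECTION `R(U₀)` OF (3.21)–(3.22) READS THE BACKGROUND ON THE BLOCK TOWERS UNDER THE `Λ_j`-SITES AND THE UNIT BALL OF `Ω₀`.**
[cite: Balaban1985BackgroundPropagators, (3.21)–(3.22) p.394] -/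
theorem projE_congr_bg (hL : 1 ≤ L)
    (hΛ : ∀ j, j ≤ m → ∀ y ∈ Λs j, AgreeOn (blockBase (L ^ j) y) (blockBase (L ^ j) y + (((L : ℤ) ^ j) - 1) • (1 : Site d)) U₀ U₀')
    (hs : ∀ x ∈ s, ∀ (y : Site d) (κ : Fin d), (∀ i, x i - 1 ≤ y i ∧ y i ≤ x i + 1) → U₀ y κ = U₀' y κ) :
    projE τ s L m η Λs U₀ = projE τ s L m η Λs U₀' := by
  unfold projE
  rw [rangeSub_congr_bg s L m η Λs hL hΛ hs]

/-- `R(U₀)` on functions reads the background there only. [cite: Balaban1985BackgroundPropagators, (3.21)–(3.22) p.394, (3.24) p.394] -/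
theorem projR_congr_bg (hL : 1 ≤ L)
    (hΛ : ∀ j, j ≤ m → ∀ y ∈ Λs j, AgreeOn (blockBase (L ^ j) y) (blockBase (L ^ j) y + (((L : ℤ) ^ j) - 1) • (1 : Site d)) U₀ U₀')
    (hs : ∀ x ∈ s, ∀ (y : Site d) (κ : Fin d), (∀ i, x i - 1 ≤ y i ∧ y i ≤ x i + 1) → U₀ y κ = U₀' y κ) (f : Site d → 𝔸) :
    projR τ s L m η Λs U₀ f = projR τ s L m η Λs U₀' f := by
  unfold projR
  rw [projE_congr_bg s L m η Λs τ hL hΛ hs]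

/-- `R(U₀)f` depends on `f` through `𝟙_{Ω₀}f` only. [cite: Balaban1985BackgroundPropagators, (3.24) p.394 («↾Ω₀»)] -/
theorem projR_congr_fun {f g : Site d → 𝔸} (h : ∀ x ∈ s, f x = g x) : projR τ s L m η Λs U₀ f = projR τ s L m η Λs U₀ g := by
  have hind : (↑s : Set (Site d)).indicator f = (↑s : Set (Site d)).indicator g := by
    funext x
    by_cases hx : x ∈ (↑s : Set (Site d))
    · rw [Set.indicator_of_mem hx, Set.indicator_of_mem hx]; exact h x (Finset.mem_coe.mp hx)
    · rw [Set.indicator_of_notMem hx, Set.indicator_of_notMem hx]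
  unfold projR
  simp only [hind]

/-- ★★ **THE GENUINE LETTER `D R(U₀) 𝟙_{Ω₀} D*` AT A MEMBER WITH FINITE `Ω₀` READS THE BACKGROUND ON: the bond itself, the bonds `(x′ − e_ν, ν)` below the
`Ω₀`-sites, the unit ball of `Ω₀` (the Laplacian in the generators of `R`) and the block towers under the `Λ_j`-sites (the averaging in `N_𝔤(Q′(U₀))`).**
[cite: Balaban1985BackgroundPropagators, (3.20)–(3.26) pp.394–395] -/
theorem opsLandau_DRDs_congr_bg {L : ℕ} (hL : 1 ≤ L) (ops₀ : ℝ → ZdIdx d L → ℕ → OpsZd d 𝔸) (M : ℝ) (i : ZdIdx d L) (m : ℕ)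
    (hΩ : (i.Ω 0).Finite) (A : Site d → Fin d → 𝔸) (x : Site d) (μ : Fin d) (hxμ : U₀ x μ = U₀' x μ)
    (hΛ : ∀ j, j ≤ m → ∀ y ∈ i.Λs m j, AgreeOn (blockBase (L ^ j) y) (blockBase (L ^ j) y + (((L : ℤ) ^ j) - 1) • (1 : Site d)) U₀ U₀')
    (hs : ∀ x' ∈ i.Ω 0, ∀ (y : Site d) (κ : Fin d), (∀ i', x' i' - 1 ≤ y i' ∧ y i' ≤ x' i' + 1) → U₀ y κ = U₀' y κ) :
    (opsLandau τ ops₀ M i m).DRDs U₀ A x μ = (opsLandau τ ops₀ M i m).DRDs U₀' A x μ := by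
  rw [opsLandau_DRDs_of_finite τ ops₀ M i m hΩ, opsLandau_DRDs_of_finite τ ops₀ M i m hΩ]
  have hs' : ∀ x' ∈ hΩ.toFinset, ∀ (y : Site d) (κ : Fin d), (∀ i', x' i' - 1 ≤ y i' ∧ y i' ≤ x' i' + 1) → U₀ y κ = U₀' y κ :=
    fun x' hx' => hs x' (hΩ.mem_toFinset.mp hx')
  have hdiv : ∀ x' ∈ hΩ.toFinset, covDivB i.η U₀ A x' = covDivB i.η U₀' A x' := by
    intro x' hx'
    refine covDivB_congr_bg A x' fun ν => hs' x' hx' _ ν fun i' => ?_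
    rw [Pi.sub_apply, B7Prop1Explicit.e_apply]; split_ifs <;> constructor <;> linarith
  rw [covDerivFwd_congr_bg μ _ x hxμ, projR_congr_fun hΩ.toFinset L m i.η (i.Λs m) τ hdiv,
    projR_congr_bg hΩ.toFinset L m i.η (i.Λs m) τ hL hΛ hs']

end Landau

/-! ## §3 The averaging letter `Q*aQ` (`QQZdP`): the (1.7) guard reads the plaquettes touching `Ω_j`, the sum reads the boxes of the class bonds of level `≥ 1` -/

section Averaging

open B7Prop1Explicit (e)
open B7Prop1Local (InBox AgreeOn loK bondHiK)
open B7Prop5Flat (bump)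
open B7Prop4GeneralLevels (linCovIter linCovIter_zero)
open B8Ineq132 (plaqF PlaqTouches BondTouches)
open B8Eq133Hypotheses (shiftT byDir byDir_apply shiftT_apply)
open B8Eq146AExpansion (iEta)
open B8LeafModelZd (ZdIdx)
open B9Eq369CurvSmallZd (val_plaqU_shiftT_byDir)
open B9Ineq3137LocalSup (linCovIter_congr)
open B9Eq316AveragingTransposeZd (Reg17 entryT linCovIterT clsField winBase wQ alphaQ)
open B9Eq316AveragingTransposeZdPrinted (QQZdP QQZdP_of_reg17 QQZdP_of_not_reg17)
open B9Eq316AveragingTransposeZdLinear (entryT_smul)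

variable {d : ℕ} {𝔸 : Type*} [CStarAlgebra 𝔸] {U₀ U₀' : Site d → Fin d → 𝔸ˣ}

/-- the plaquette field `U(∂p_{μν}(x))` reads the background on the ℓ∞-unit ball of `x`. [cite: Balaban1985RegularSpaces, (1.2) p.76] -/
theorem plaqF_congr_bg (μ ν : Fin d) (x : Site d)
    (h : ∀ (y : Site d) (κ : Fin d), (∀ i, x i - 1 ≤ y i ∧ y i ≤ x i + 1) → U₀ y κ = U₀' y κ) : plaqF U₀ μ ν x = plaqF U₀' μ ν x := by
  have hx0 : ∀ κ, U₀ x κ = U₀' x κ := fun κ => h x κ fun i => ⟨by linarith, by linarith⟩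
  have hp : ∀ ν' κ, U₀ (x + e ν') κ = U₀' (x + e ν') κ := fun ν' κ => h _ κ fun i => by
    rw [Pi.add_apply, B7Prop1Explicit.e_apply]; split_ifs <;> constructor <;> linarith
  rw [← val_plaqU_shiftT_byDir, ← val_plaqU_shiftT_byDir]
  congr 1
  refine plaqU_congr_bg (shiftT d) ?_ ?_ ?_ ?_ <;> simp only [byDir_apply, shiftT_apply]
  exacts [hx0 μ, hp μ ν, hp ν μ, hx0 ν]

/-- **THE CLASS (1.7) GUARD READS THE PLAQUETTES TOUCHING THE `Ω_j`**: `Reg17 L m Ω α U₀ ↔ Reg17 L m Ω α U₀′` when the backgrounds agree on the unit balls of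
the bases of those plaquettes. [cite: Balaban1985RegularSpaces, (1.7) p.77] -/
theorem reg17_congr_bg {L m : ℕ} {Ω : ℕ → Set (Site d)} {α : ℝ}
    (h : ∀ j, j ≤ m → ∀ (x : Site d) (μ ν : Fin d), μ ≠ ν → PlaqTouches (Ω j) x μ ν →
      ∀ (y : Site d) (κ : Fin d), (∀ i, x i - 1 ≤ y i ∧ y i ≤ x i + 1) → U₀ y κ = U₀' y κ) :
    Reg17 L m Ω α U₀ ↔ Reg17 L m Ω α U₀' := by
  refine ⟨fun hr j hj x μ ν hμν hp => ?_, fun hr j hj x μ ν hμν hp => ?_⟩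
  · rw [← plaqF_congr_bg μ ν x (h j hj x μ ν hμν hp)]; exact hr j hj x μ ν hμν hp
  · rw [plaqF_congr_bg μ ν x (h j hj x μ ν hμν hp)]; exact hr j hj x μ ν hμν hp

variable {L : ℕ}

/-- **THE LEVEL-`j` CLASS FIELD `𝟙_{Λ_j}LʲηQ_j(U₀)A` READS THE BOXES OF THE CLASS BONDS OF LEVEL `j ≥ 1`** (`linCovIter_congr`; level `0` reads no background).
[cite: Balaban1985Averaging, p.24 (after (43)), (127) p.37; Balaban1985BackgroundPropagators, (3.16) p.393] -/
theorem clsField_congr_bg (hL : 1 ≤ L) (ΛbP : ℕ → ℕ → Set (Site d × Fin d)) (η : ℝ) (m j : ℕ) (A : Site d → Fin d → 𝔸)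
    (hcls : 1 ≤ j → ∀ c ∈ ΛbP m j, AgreeOn (loK L j c.1) (bondHiK L j c.1 c.2) U₀ U₀') :
    clsField L ΛbP η m j U₀ A = clsField L ΛbP η m j U₀' A := by
  classical
  funext z κ
  unfold clsField
  split_ifs with hc
  · rcases Nat.eq_zero_or_pos j with rfl | hj1
    · rw [linCovIter_zero, linCovIter_zero]
    · rw [linCovIter_congr L hL j z κ (hcls hj1 (z, κ) hc) (fun _ _ _ _ => rfl)]
  · rfl

/-- `Eᵀ 0 = 0` (from real homogeneity). [cite: Balaban1985BackgroundPropagators, (3.16) p.393 (bookkeeping)] -/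
private theorem entryT_zero' [FiniteDimensional ℝ 𝔸] (τ : 𝔸 →ₗ[ℂ] ℂ) (E : 𝔸 → 𝔸) : entryT τ E 0 = 0 := by
  simpa using entryT_smul τ E 0 0

/-- **THE TRANSPOSE `Q_jᵀ` APPLIED TO THE CLASS FIELD READS THE SAME BOXES**: the columns at the window bonds carrying class values are `Q_j` at class bonds.
[cite: Balaban1985BackgroundPropagators, (3.16) p.393; Balaban1985Averaging, (147) p.40, p.24] -/
theorem linCovIterT_clsField_congr_bg [FiniteDimensional ℝ 𝔸] (τ : 𝔸 →ₗ[ℂ] ℂ) (hL : 1 ≤ L) (ΛbP : ℕ → ℕ → Set (Site d × Fin d)) (η : ℝ)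
    (m j : ℕ) (A : Site d → Fin d → 𝔸) (hcls : 1 ≤ j → ∀ c ∈ ΛbP m j, AgreeOn (loK L j c.1) (bondHiK L j c.1 c.2) U₀ U₀')
    (y : Site d) (μ : Fin d) :
    linCovIterT τ L U₀ j (clsField L ΛbP η m j U₀ A) y μ = linCovIterT τ L U₀' j (clsField L ΛbP η m j U₀' A) y μ := by
  classical
  rw [clsField_congr_bg hL ΛbP η m j A hcls]
  unfold linCovIterT
  refine Finset.sum_congr rfl fun κ _ => Finset.sum_congr rfl fun t _ => ?_
  by_cases hc : (winBase L j y κ t, κ) ∈ ΛbP m j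
  · have hE : (fun X => linCovIter L U₀ (bump y μ X) j (winBase L j y κ t) κ) =
        fun X => linCovIter L U₀' (bump y μ X) j (winBase L j y κ t) κ := by
      funext X
      rcases Nat.eq_zero_or_pos j with rfl | hj1
      · rw [linCovIter_zero, linCovIter_zero]
      · exact linCovIter_congr L hL j _ κ (hcls hj1 _ hc) (fun _ _ _ _ => rfl)
    rw [hE]
  · have h0 : clsField L ΛbP η m j U₀' A (winBase L j y κ t) κ = 0 := by simp [clsField, hc]
    rw [h0, entryT_zero', entryT_zero']

/-- ★ **THE GENUINE `Q*aQ` LETTER READS THE BACKGROUND ON THE PLAQUETTES TOUCHING THE `Ω_j` (its (1.7) guard) AND ON THE BOXES OF THE CLASS BONDS OF LEVEL `≥ 1`**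
(print's (1.31): box ⊂ Ω_{j−1}). [cite: Balaban1985BackgroundPropagators, (3.16) p.393; Balaban1985RegularSpaces, (1.7) p.77, (1.31) p.82; Balaban1985Averaging, p.24] -/
theorem QQZdP_congr_bg [FiniteDimensional ℝ 𝔸] (τ : 𝔸 →ₗ[ℂ] ℂ) (hL : 1 ≤ L) (ΛbP : ℕ → ℕ → Set (Site d × Fin d)) (i : ZdIdx d L) (m : ℕ)
    (A : Site d → Fin d → 𝔸) (y : Site d) (μ : Fin d)
    (h17 : ∀ j, j ≤ m → ∀ (x : Site d) (μ' ν : Fin d), μ' ≠ ν → PlaqTouches (i.Ω j) x μ' ν →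
      ∀ (z : Site d) (κ : Fin d), (∀ i', x i' - 1 ≤ z i' ∧ z i' ≤ x i' + 1) → U₀ z κ = U₀' z κ)
    (hcls : ∀ j, 1 ≤ j → j ≤ m → ∀ c ∈ ΛbP m j, AgreeOn (loK L j c.1) (bondHiK L j c.1 c.2) U₀ U₀') :
    QQZdP τ L ΛbP i m U₀ A y μ = QQZdP τ L ΛbP i m U₀' A y μ := by
  have hiff := reg17_congr_bg (L := L) (m := m) (Ω := i.Ω) (α := alphaQ d L / (L : ℝ) ^ 2) h17
  by_cases hreg : Reg17 L m i.Ω (alphaQ d L / (L : ℝ) ^ 2) U₀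
  · rw [QQZdP_of_reg17 τ L hreg, QQZdP_of_reg17 τ L (hiff.mp hreg)]
    refine Finset.sum_congr rfl fun j hjm => ?_
    have hj : j ≤ m := by rw [Finset.mem_range] at hjm; omega
    rw [linCovIterT_clsField_congr_bg τ hL ΛbP i.η m j A (fun hj1 => hcls j hj1 hj) y μ]
  · rw [QQZdP_of_not_reg17 τ L hreg, QQZdP_of_not_reg17 τ L (fun h => hreg (hiff.mpr h))]

end Averaging

/-! ## §4 `Δ_a(U₀)` of the four-letter record on the bonds of `Ω₀`, and the regularity predicates, read the background near `Ω₀` only -/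

section Record

open B7Prop1Explicit (e)
open B7Prop1Local (InBox AgreeOn loK bondHiK)
open B7Prop2Explicit (unitaryUnits)
open Literature.MathematicalPhysics.QuantumLattice (blockBase)
open B8Ineq132 (PlaqTouches BondTouches)
open B8Eq155JBound (Jcur)
open B8Ineq159CurvedCubeMemberLocal (Jcur_congr_bg)
open B8LeafModelZd (ZdIdx)
open B9Eq369CurvSmallZd (DpZd)
open B9SupplySockB9P3ZdLetters (OpsZd deltaAOf)
open B9SupplySockB9P3ZdLettersOmega (restrictDom)
open B9Eq321LandauProjectionZd (opsLandau)
open B9Eq327GreenZd (domSub deltaADom RegularAt LinearOnDomAt bondPair bondPair_restrictDom_right)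
open B9Eq327GreenZdHerm (domSubH RegularAtH HermPreservingAt domSubH_le)
open B9Eq316AveragingTransposeZdPrinted (QQZdP withQQP)
open B9SupplySockB9P3ZdGammaInAkDpZd (withDpZd)
open B9SupplySockB9P3ZdAllLettersZd (opsAllZd)

variable {d : ℕ} {𝔸 : Type*} [CStarAlgebra 𝔸]

/-- **`Δ_a↾Ω₀` READS `Δ_a` ON THE BONDS OF `Ω₀` ONLY** (any letter record): agreement of `Δ_a(U)A` and `Δ_a(U′)A` there gives `deltaADom … U A = deltaADom … U′ A`.
[cite: Balaban1985BackgroundPropagators, (3.27) p.395 («Ω₀Δ_aΩ₀»)] -/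
theorem deltaADom_congr_of_bonds (η : ℝ) (o : OpsZd d 𝔸) (Ω₀ : Set (Site d)) {U U' : Site d → Fin d → 𝔸ˣ} {A : Site d → Fin d → 𝔸}
    (h : ∀ (y : Site d) (τ : Fin d), BondTouches Ω₀ y τ → deltaAOf η o U A y τ = deltaAOf η o U' A y τ) :
    deltaADom η o Ω₀ U A = deltaADom η o Ω₀ U' A := by
  classical
  funext y τ
  simp only [deltaADom, restrictDom]
  split_ifs with hb
  · exact h y τ hb
  · rfl

/-- **`RegularAt` READS `Δ_a↾Ω₀` ON `E(Ω₀)` ONLY** (any record). [cite: Balaban1985BackgroundPropagators, (3.27) p.395, Thm 3.11 p.416] -/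
theorem regularAt_congr_of_deltaADom (η : ℝ) (o : OpsZd d 𝔸) (Ω₀ : Set (Site d)) {U U' : Site d → Fin d → 𝔸ˣ}
    (h : ∀ A ∈ domSub (𝔸 := 𝔸) Ω₀, deltaADom η o Ω₀ U A = deltaADom η o Ω₀ U' A) :
    RegularAt η o Ω₀ U ↔ RegularAt η o Ω₀ U' := by
  constructor
  · rintro ⟨Φ, hΦ, hbij⟩
    exact ⟨Φ, fun A => by rw [hΦ A, h A A.2], hbij⟩
  · rintro ⟨Φ, hΦ, hbij⟩
    exact ⟨Φ, fun A => by rw [hΦ A, ← h A A.2], hbij⟩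

/-- **`RegularAtH` READS `Δ_a↾Ω₀` ON `E_𝔤(Ω₀)` ONLY** (any record). [cite: Balaban1985BackgroundPropagators, (3.27) p.395, Thm 3.11 p.416, p.391] -/
theorem regularAtH_congr_of_deltaADom (η : ℝ) (o : OpsZd d 𝔸) (Ω₀ : Set (Site d)) {U U' : Site d → Fin d → 𝔸ˣ}
    (h : ∀ A ∈ domSubH (𝔸 := 𝔸) Ω₀, deltaADom η o Ω₀ U A = deltaADom η o Ω₀ U' A) :
    RegularAtH η o Ω₀ U ↔ RegularAtH η o Ω₀ U' := by
  constructor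
  · rintro ⟨Φ, hΦ, hbij⟩
    exact ⟨Φ, fun A => by rw [hΦ A, h A A.2], hbij⟩
  · rintro ⟨Φ, hΦ, hbij⟩
    exact ⟨Φ, fun A => by rw [hΦ A, ← h A A.2], hbij⟩

/-- **`HermPreservingAt` READS `Δ_a` ON THE BONDS OF `Ω₀` ONLY** (any record). [cite: Balaban1985BackgroundPropagators, (3.26) p.395, p.391] -/
theorem hermPreservingAt_congr_of_bonds (η : ℝ) (o : OpsZd d 𝔸) (Ω₀ : Set (Site d)) {U U' : Site d → Fin d → 𝔸ˣ}
    (h : ∀ A ∈ domSubH (𝔸 := 𝔸) Ω₀, ∀ (y : Site d) (τ : Fin d), BondTouches Ω₀ y τ → deltaAOf η o U A y τ = deltaAOf η o U' A y τ) :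
    HermPreservingAt η o Ω₀ U ↔ HermPreservingAt η o Ω₀ U' :=
  ⟨fun hh A hA y τ hb => by rw [← h A hA y τ hb]; exact hh A hA y τ hb,
    fun hh A hA y τ hb => by rw [h A hA y τ hb]; exact hh A hA y τ hb⟩

/-- **THE PAIRING `⟨A, Δ_a(U₀)A⟩_τ` READS `Δ_a` ON THE BONDS OF `Ω₀` ONLY** for `A ∈ E(Ω₀)` (any record; positivity transfers with it).
[cite: Balaban1985BackgroundPropagators, (3.27) p.395, Thm 3.11 p.416] -/
theorem bondPair_deltaAOf_congr_of_bonds (τ : 𝔸 →ₗ[ℂ] ℂ) (η : ℝ) (o : OpsZd d 𝔸) (Ω₀ : Set (Site d)) {U U' : Site d → Fin d → 𝔸ˣ}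
    {A : Site d → Fin d → 𝔸} (hA : A ∈ domSub (𝔸 := 𝔸) Ω₀)
    (h : ∀ (y : Site d) (μ : Fin d), BondTouches Ω₀ y μ → deltaAOf η o U A y μ = deltaAOf η o U' A y μ) :
    bondPair τ A (deltaAOf η o U A) = bondPair τ A (deltaAOf η o U' A) := by
  rw [← bondPair_restrictDom_right τ hA (deltaAOf η o U A), ← bondPair_restrictDom_right τ hA (deltaAOf η o U' A)]
  exact congrArg _ (deltaADom_congr_of_bonds η o Ω₀ h)

variable (τ : 𝔸 →ₗ[ℂ] ℂ) [FiniteDimensional ℝ 𝔸] {L : ℕ}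

/-- ★★ **`Δ_a(U₀)` OF THE FOUR-LETTER RECORD AT A BOND READS THE BACKGROUND NEAR THE MEMBER ONLY** (finite `Ω₀`, `L ≥ 1`): the four letters agree at
`b = ⟨x, x+e_μ⟩` for backgrounds `U₀`, `U₀′` which agree (i) on the ℓ∞-unit ball of `x` (`D*D`, `Δ′`), (ii) on the unit balls of the `Ω₀`-sites and the block
towers under the `Λ_j`-sites (`D R(U₀) 𝟙 D*`), (iii) on the unit balls of the bases of the plaquettes touching the `Ω_j` and on the boxes of the class bonds of
level `≥ 1` (`Q*aQ`). [cite: Balaban1985BackgroundPropagators, (3.26) p.395, (3.10) p.392, (3.16) p.393, (3.20)–(3.25) p.394] -/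
theorem deltaAOf_opsAllZd_congr_bg (hL : 1 ≤ L) (ΛbP : ℕ → ℕ → Set (Site d × Fin d)) (ops₀ : ℝ → ZdIdx d L → ℕ → OpsZd d 𝔸) (M : ℝ)
    (i : ZdIdx d L) (m : ℕ) (hΩ : (i.Ω 0).Finite) {U₀ U₀' : Site d → Fin d → 𝔸ˣ} (A : Site d → Fin d → 𝔸) (x : Site d) (μ : Fin d)
    (hx : ∀ (y : Site d) (κ : Fin d), (∀ i', x i' - 1 ≤ y i' ∧ y i' ≤ x i' + 1) → U₀ y κ = U₀' y κ)
    (hs : ∀ x' ∈ i.Ω 0, ∀ (y : Site d) (κ : Fin d), (∀ i', x' i' - 1 ≤ y i' ∧ y i' ≤ x' i' + 1) → U₀ y κ = U₀' y κ)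
    (hΛ : ∀ j, j ≤ m → ∀ y ∈ i.Λs m j, AgreeOn (blockBase (L ^ j) y) (blockBase (L ^ j) y + (((L : ℤ) ^ j) - 1) • (1 : Site d)) U₀ U₀')
    (h17 : ∀ j, j ≤ m → ∀ (x' : Site d) (μ' ν : Fin d), μ' ≠ ν → PlaqTouches (i.Ω j) x' μ' ν →
      ∀ (z : Site d) (κ : Fin d), (∀ i', x' i' - 1 ≤ z i' ∧ z i' ≤ x' i' + 1) → U₀ z κ = U₀' z κ)
    (hcls : ∀ j, 1 ≤ j → j ≤ m → ∀ c ∈ ΛbP m j, AgreeOn (loK L j c.1) (bondHiK L j c.1 c.2) U₀ U₀') :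
    deltaAOf i.η (opsAllZd τ L ΛbP ops₀ M i m) U₀ A x μ = deltaAOf i.η (opsAllZd τ L ΛbP ops₀ M i m) U₀' A x μ := by
  have hxμ : U₀ x μ = U₀' x μ := hx x μ fun i' => ⟨by linarith, by linarith⟩
  show Jcur i.η U₀ A μ x + DpZd i.η U₀ A x μ + (opsLandau τ (withDpZd (withQQP τ L ΛbP ops₀)) M i m).DRDs U₀ A x μ + QQZdP τ L ΛbP i m U₀ A x μ =
    Jcur i.η U₀' A μ x + DpZd i.η U₀' A x μ + (opsLandau τ (withDpZd (withQQP τ L ΛbP ops₀)) M i m).DRDs U₀' A x μ + QQZdP τ L ΛbP i m U₀' A x μ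
  rw [Jcur_congr_bg A μ x hx, DpZd_congr_bg i.η A x μ hx, opsLandau_DRDs_congr_bg τ hL _ M i m hΩ A x μ hxμ hΛ hs,
    QQZdP_congr_bg τ hL ΛbP i m A x μ h17 hcls]

/-- ★★★ **`RegularAtH` ∕ `RegularAt` ∕ `HermPreservingAt` ∕ THE FORM `⟨A, Δ_aA⟩_τ` OF THE FOUR-LETTER RECORD READ THE BACKGROUND NEAR THE MEMBER ONLY**: if the
genuine `Δ_a(U₀)A` and `Δ_a(U₀′)A` agree at every bond touching `Ω₀` for every field `A` (as `deltaAOf_opsAllZd_congr_bg` provides), the three predicates and the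
pairing transfer. [cite: Balaban1985BackgroundPropagators, (3.27) p.395, Thm 3.11 p.416] -/
theorem regular_opsAllZd_congr_of_key (ΛbP : ℕ → ℕ → Set (Site d × Fin d)) (ops₀ : ℝ → ZdIdx d L → ℕ → OpsZd d 𝔸) (M : ℝ)
    (i : ZdIdx d L) (m : ℕ) {U₀ U₀' : Site d → Fin d → 𝔸ˣ}
    (key : ∀ (A : Site d → Fin d → 𝔸) (y : Site d) (μ : Fin d), BondTouches (i.Ω 0) y μ →
      deltaAOf i.η (opsAllZd τ L ΛbP ops₀ M i m) U₀ A y μ = deltaAOf i.η (opsAllZd τ L ΛbP ops₀ M i m) U₀' A y μ) :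
    (RegularAtH i.η (opsAllZd τ L ΛbP ops₀ M i m) (i.Ω 0) U₀ ↔ RegularAtH i.η (opsAllZd τ L ΛbP ops₀ M i m) (i.Ω 0) U₀') ∧
      (RegularAt i.η (opsAllZd τ L ΛbP ops₀ M i m) (i.Ω 0) U₀ ↔ RegularAt i.η (opsAllZd τ L ΛbP ops₀ M i m) (i.Ω 0) U₀') ∧
      (HermPreservingAt i.η (opsAllZd τ L ΛbP ops₀ M i m) (i.Ω 0) U₀ ↔ HermPreservingAt i.η (opsAllZd τ L ΛbP ops₀ M i m) (i.Ω 0) U₀') ∧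
      (∀ A ∈ domSub (𝔸 := 𝔸) (i.Ω 0), bondPair τ A (deltaAOf i.η (opsAllZd τ L ΛbP ops₀ M i m) U₀ A) =
        bondPair τ A (deltaAOf i.η (opsAllZd τ L ΛbP ops₀ M i m) U₀' A)) :=
  ⟨regularAtH_congr_of_deltaADom i.η _ (i.Ω 0) fun A _ => deltaADom_congr_of_bonds i.η _ (i.Ω 0) (key A),
    regularAt_congr_of_deltaADom i.η _ (i.Ω 0) fun A _ => deltaADom_congr_of_bonds i.η _ (i.Ω 0) (key A),
    hermPreservingAt_congr_of_bonds i.η _ (i.Ω 0) fun A _ y μ hyμ => key A y μ hyμ,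
    fun A hA => bondPair_deltaAOf_congr_of_bonds τ i.η _ (i.Ω 0) hA (key A)⟩

/-- ★★★ **THE SAME FROM THE AGREEMENT HYPOTHESES OF `deltaAOf_opsAllZd_congr_bg`** (finite `Ω₀`, `L ≥ 1`). [cite: Balaban1985BackgroundPropagators, (3.27) p.395, Thm 3.11 p.416] -/
theorem regular_opsAllZd_congr_bg (hL : 1 ≤ L) (ΛbP : ℕ → ℕ → Set (Site d × Fin d)) (ops₀ : ℝ → ZdIdx d L → ℕ → OpsZd d 𝔸) (M : ℝ)
    (i : ZdIdx d L) (m : ℕ) (hΩ : (i.Ω 0).Finite) {U₀ U₀' : Site d → Fin d → 𝔸ˣ}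
    (hb : ∀ (x : Site d) (μ : Fin d), BondTouches (i.Ω 0) x μ →
      ∀ (y : Site d) (κ : Fin d), (∀ i', x i' - 1 ≤ y i' ∧ y i' ≤ x i' + 1) → U₀ y κ = U₀' y κ)
    (hs : ∀ x' ∈ i.Ω 0, ∀ (y : Site d) (κ : Fin d), (∀ i', x' i' - 1 ≤ y i' ∧ y i' ≤ x' i' + 1) → U₀ y κ = U₀' y κ)
    (hΛ : ∀ j, j ≤ m → ∀ y ∈ i.Λs m j, AgreeOn (blockBase (L ^ j) y) (blockBase (L ^ j) y + (((L : ℤ) ^ j) - 1) • (1 : Site d)) U₀ U₀')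
    (h17 : ∀ j, j ≤ m → ∀ (x' : Site d) (μ' ν : Fin d), μ' ≠ ν → PlaqTouches (i.Ω j) x' μ' ν →
      ∀ (z : Site d) (κ : Fin d), (∀ i', x' i' - 1 ≤ z i' ∧ z i' ≤ x' i' + 1) → U₀ z κ = U₀' z κ)
    (hcls : ∀ j, 1 ≤ j → j ≤ m → ∀ c ∈ ΛbP m j, AgreeOn (loK L j c.1) (bondHiK L j c.1 c.2) U₀ U₀') :
    (RegularAtH i.η (opsAllZd τ L ΛbP ops₀ M i m) (i.Ω 0) U₀ ↔ RegularAtH i.η (opsAllZd τ L ΛbP ops₀ M i m) (i.Ω 0) U₀') ∧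
      (RegularAt i.η (opsAllZd τ L ΛbP ops₀ M i m) (i.Ω 0) U₀ ↔ RegularAt i.η (opsAllZd τ L ΛbP ops₀ M i m) (i.Ω 0) U₀') ∧
      (HermPreservingAt i.η (opsAllZd τ L ΛbP ops₀ M i m) (i.Ω 0) U₀ ↔ HermPreservingAt i.η (opsAllZd τ L ΛbP ops₀ M i m) (i.Ω 0) U₀') ∧
      (∀ A ∈ domSub (𝔸 := 𝔸) (i.Ω 0), bondPair τ A (deltaAOf i.η (opsAllZd τ L ΛbP ops₀ M i m) U₀ A) =
        bondPair τ A (deltaAOf i.η (opsAllZd τ L ΛbP ops₀ M i m) U₀' A)) :=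
  regular_opsAllZd_congr_of_key τ ΛbP ops₀ M i m fun A y μ hyμ =>
    deltaAOf_opsAllZd_congr_bg τ hL ΛbP ops₀ M i m hΩ A y μ (hb y μ hyμ) hs hΛ h17 hcls

end Record

/-! ## §5 The cube member: agreement on the box `□₀ ± 3` suffices -/

section Cube

open Literature.MathematicalPhysics.QuantumLattice (blockBase)
open B7Prop1Explicit (e)
open B7Prop1Local (InBox AgreeOn loK bondHiK)
open B8Ineq132 (Under PlaqTouches BondTouches)
open B8Eq131Cubes (cube sqLo sqHi cube_anti mem_cube_iff)
open B8Eq131CubesAdmissible (cubeFam cubeFam_false_of_le cubeFam_false_zero)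
open B8CubeMemberZd (cubeLamS inBox_sq_of_mem_cubeLamS)
open B8Ineq159FlatCubeMemberPrinted (cubeLamBP)
open B8LeafModelZd (ZdIdx)
open B9SupplySockB9P3ZdLetters (OpsZd)
open B9Eq327GreenZd (RegularAt)
open B9Eq327GreenZdHerm (RegularAtH HermPreservingAt)
open B9SupplySockB9P3ZdAllLettersZd (opsAllZd)
open B9Eq316AveragingTransposeZdLevelZero (hbox0_cubeLamBP_of_eq)

variable {d : ℕ} {𝔸 : Type*} [CStarAlgebra 𝔸]

omit [CStarAlgebra 𝔸] in
/-- agreement on the box `[lo, hi]` gives pointwise agreement at every bond `(y, κ)` with `lo ≤ y` and `y + 𝟙 ≤ hi`. [folklore] -/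
private theorem agree_pt {G : Type*} {lo hi : Site d} {U U' : Site d → Fin d → G} (hag : AgreeOn lo hi U U') {y : Site d}
    (hy : ∀ i, lo i ≤ y i ∧ y i + 1 ≤ hi i) (κ : Fin d) : U y κ = U' y κ := by
  refine hag y κ (fun i => ⟨(hy i).1, by linarith [(hy i).2]⟩) (fun i => ?_)
  rw [B7Prop1Local.add_e_apply]
  split_ifs <;> constructor <;> linarith [(hy i).1, (hy i).2]

omit [CStarAlgebra 𝔸] in
/-- the unit ball of a site within `[sqLo₀ − 1, sqHi₀ + 1]` is read through the box `□₀ ± 3`. [folklore] -/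
private theorem agree_ball {G : Type*} {lo₀ hi₀ : Site d} {U U' : Site d → Fin d → G}
    (hag : AgreeOn (fun i => lo₀ i - 3) (fun i => hi₀ i + 3) U U') {x : Site d} (hx : ∀ i, lo₀ i - 1 ≤ x i ∧ x i ≤ hi₀ i + 1) :
    ∀ (y : Site d) (κ : Fin d), (∀ i, x i - 1 ≤ y i ∧ y i ≤ x i + 1) → U y κ = U' y κ :=
  fun y κ hy => agree_pt hag (fun i => ⟨by linarith [(hx i).1, (hy i).1], by linarith [(hx i).2, (hy i).2]⟩) κ

omit [CStarAlgebra 𝔸] in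
/-- a corner of a plaquette ∕ an end of a bond in the box `[lo₀, hi₀]` puts the base within `[lo₀ − 1, hi₀ + 1]`. [folklore] -/
private theorem near_of_shift {lo₀ hi₀ x t : Site d} (ht : ∀ i, 0 ≤ t i ∧ t i ≤ 1) (h : InBox lo₀ hi₀ (x + t)) :
    ∀ i, lo₀ i - 1 ≤ x i ∧ x i ≤ hi₀ i + 1 := fun i => by
  have h1 := (h i).1; have h2 := (h i).2
  simp only [Pi.add_apply] at h1 h2
  constructor <;> linarith [(ht i).1, (ht i).2]

omit [CStarAlgebra 𝔸] in
/-- `e_μ` has coordinates in `{0, 1}`. [folklore] -/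
private theorem e_coord (μ : Fin d) : ∀ i, 0 ≤ (e μ : Site d) i ∧ (e μ : Site d) i ≤ 1 := fun i => by
  rw [B7Prop1Explicit.e_apply]; split_ifs <;> simp

omit [CStarAlgebra 𝔸] in
/-- `e_μ + e_ν` shifted plaquette corner: base within one of the box when the far corner is in it. [folklore] -/
private theorem near_of_far_corner {lo₀ hi₀ x : Site d} {μ ν : Fin d} (hμν : μ ≠ ν) (h : InBox lo₀ hi₀ (x + e μ + e ν)) :
    ∀ i, lo₀ i - 1 ≤ x i ∧ x i ≤ hi₀ i + 1 := by
  rw [add_assoc] at h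
  refine near_of_shift (fun i => ?_) h
  simp only [Pi.add_apply, B7Prop1Explicit.e_apply]
  have : ¬ (i = μ ∧ i = ν) := fun ⟨h1, h2⟩ => hμν (h1.symm.trans h2)
  split_ifs <;> simp_all

/-- the fine block under a level-`j` site of `□_j^{(j)}` lies in `□₀` (`□_j` is a union of `Lʲ`-blocks, `□_j ⊂ □₀`). [cite: Balaban1985RegularSpaces, (1.131) p.99, p.98] -/
private theorem block_corner_mem_cube_zero {L : ℕ} (hL : 1 ≤ L) (a : Site d) (Mc ρ : ℕ) {k j : ℕ} (hj : j ≤ k) {y : Site d}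
    (hy : InBox (sqLo L a ρ k j) (sqHi L a Mc ρ k j) y) {z : Site d} (hz : Under L j y z) : z ∈ cube L a Mc ρ k 0 :=
  cube_anti (Nat.zero_le j) hj ((mem_cube_iff hL).2 ⟨y, hy, hz⟩)

variable (τ : 𝔸 →ₗ[ℂ] ℂ) [FiniteDimensional ℝ 𝔸] {L : ℕ}

/-- ★★★ **AT A CUBE MEMBER, `RegularAtH` ∕ `RegularAt` ∕ `HermPreservingAt` OF THE FOUR-LETTER RECORD AT PRINT'S CLASS READ THE BACKGROUND ON THE BOX `□₀ ± 3` ONLY**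
(`Ω = cubeFam false …`, `Λs = cubeLamS …`, class `cubeLamBP`, `m ≤ k`, `2 ≤ L ≤ ρ`): unitary backgrounds agreeing on the bonds of
`[sqLo₀ − 3·𝟙, sqHi₀ + 3·𝟙]` have the same three predicates — the (L) input of `B9Thm311GaugeReductionZd.of_pdevOn_lt` for this `P`.
[cite: Balaban1985BackgroundPropagators, (3.26)–(3.27) p.395, Thm 3.11 p.416; Balaban1985RegularSpaces, (1.131) p.99; Balaban1985Averaging, p.24 (locality)] -/
theorem regular_opsAllZd_congr_cube (hL : 2 ≤ L) (ops₀ : ℝ → ZdIdx d L → ℕ → OpsZd d 𝔸) (M : ℝ) (i : ZdIdx d L)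
    {a : Site d} {Mc ρ : ℕ} (hρ : L ≤ ρ) (hΩ : i.Ω = cubeFam false L a Mc ρ i.k) (hΛs : i.Λs = cubeLamS L a Mc ρ i.k)
    (hfin : (i.Ω 0).Finite) {m : ℕ} (hm : m ≤ i.k) {U₀ U₀' : Site d → Fin d → 𝔸ˣ}
    (hag : AgreeOn (fun i' => sqLo L a ρ i.k 0 i' - 3) (fun i' => sqHi L a Mc ρ i.k 0 i' + 3) U₀ U₀') :
    (RegularAtH i.η (opsAllZd τ L (cubeLamBP L a Mc ρ i.k) ops₀ M i m) (i.Ω 0) U₀ ↔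
        RegularAtH i.η (opsAllZd τ L (cubeLamBP L a Mc ρ i.k) ops₀ M i m) (i.Ω 0) U₀') ∧
      (RegularAt i.η (opsAllZd τ L (cubeLamBP L a Mc ρ i.k) ops₀ M i m) (i.Ω 0) U₀ ↔
        RegularAt i.η (opsAllZd τ L (cubeLamBP L a Mc ρ i.k) ops₀ M i m) (i.Ω 0) U₀') ∧
      (HermPreservingAt i.η (opsAllZd τ L (cubeLamBP L a Mc ρ i.k) ops₀ M i m) (i.Ω 0) U₀ ↔
        HermPreservingAt i.η (opsAllZd τ L (cubeLamBP L a Mc ρ i.k) ops₀ M i m) (i.Ω 0) U₀') ∧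
      (∀ A ∈ B9Eq327GreenZd.domSub (𝔸 := 𝔸) (i.Ω 0),
        B9Eq327GreenZd.bondPair τ A (B9SupplySockB9P3ZdLetters.deltaAOf i.η (opsAllZd τ L (cubeLamBP L a Mc ρ i.k) ops₀ M i m) U₀ A) =
          B9Eq327GreenZd.bondPair τ A (B9SupplySockB9P3ZdLetters.deltaAOf i.η (opsAllZd τ L (cubeLamBP L a Mc ρ i.k) ops₀ M i m) U₀' A)) := by
  have hL1 : 1 ≤ L := le_trans (by norm_num) hL
  -- `Ω_j = □_j ⊂ □₀ = [sqLo₀, sqHi₀]`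
  have hΩj : ∀ j, j ≤ m → i.Ω j ⊆ cube L a Mc ρ i.k 0 := fun j hj => by
    rw [hΩ, cubeFam_false_of_le L a Mc ρ (hj.trans hm)]; exact cube_anti (Nat.zero_le j) (hj.trans hm)
  have hbox0 : ∀ {x : Site d}, x ∈ cube L a Mc ρ i.k 0 → ∀ i', sqLo L a ρ i.k 0 i' - 1 ≤ x i' ∧ x i' ≤ sqHi L a Mc ρ i.k 0 i' + 1 :=
    fun {x} hx i' => by
      have h := (B8Ineq159FlatCubeMemberKernel.mem_cube_zero_iff L a Mc ρ i.k x).1 hx i'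
      exact ⟨by linarith [h.1], by linarith [h.2]⟩
  refine regular_opsAllZd_congr_bg τ hL1 _ ops₀ M i m hfin (fun x μ hb => ?_) (fun x' hx' => ?_) (fun j hj y hy => ?_)
    (fun j hj x μ' ν hμν hp => ?_) (fun j hj1 hj c hc => ?_)
  · -- (i) bonds touching `□₀`
    refine agree_ball hag ?_
    rcases hb with h | h
    · exact hbox0 (hΩj 0 (Nat.zero_le m) h)
    · exact near_of_shift (e_coord μ) (hΩj 0 (Nat.zero_le m) h)
  · -- (ii) sites of `□₀`
    exact agree_ball hag (hbox0 (hΩj 0 (Nat.zero_le m) hx'))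
  · -- (ii′) block towers under the `Λ_j`-sites
    rw [hΛs] at hy
    have hyb := inBox_sq_of_mem_cubeLamS hy
    have hjk : j ≤ i.k := hj.trans hm
    have hPj : (1 : ℤ) ≤ (L : ℤ) ^ j := one_le_pow₀ (by exact_mod_cast hL1)
    have hcorner : ∀ z : Site d, Under L j y z → ∀ i', sqLo L a ρ i.k 0 i' ≤ z i' ∧ z i' ≤ sqHi L a Mc ρ i.k 0 i' :=
      fun z hz i' => (B8Ineq159FlatCubeMemberKernel.mem_cube_zero_iff L a Mc ρ i.k z).1 (block_corner_mem_cube_zero hL1 a Mc ρ hjk hyb hz) i'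
    have hlo : Under L j y (blockBase (L ^ j) y) := fun i' => by
      simp only [blockBase]; push_cast; constructor <;> nlinarith
    have hhi : Under L j y (blockBase (L ^ j) y + (((L : ℤ) ^ j) - 1) • (1 : Site d)) := fun i' => by
      simp only [blockBase, Pi.add_apply, Pi.smul_apply, Pi.one_apply, smul_eq_mul, mul_one]; push_cast
      constructor <;> nlinarith
    refine hag.mono (fun i' => ?_) (fun i' => ?_)
    · linarith [(hcorner _ hlo i').1]
    · linarith [(hcorner _ hhi i').2]
  · -- (iii) plaquettes touching `□_j ⊂ □₀`
    refine agree_ball hag ?_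
    rcases hp with h | h | h | h
    · exact hbox0 (hΩj j hj h)
    · exact near_of_shift (e_coord μ') (hΩj j hj h)
    · exact near_of_shift (e_coord ν) (hΩj j hj h)
    · exact near_of_far_corner hμν (hΩj j hj h)
  · -- (iii′) boxes of the class bonds of level `j ≥ 1` lie in `Ω_{j−1} ⊂ □₀`
    have hsub := hbox0_cubeLamBP_of_eq hL1 i a Mc hρ hΩ hm j hj1 hj c hc
    have hjk : j - 1 ≤ i.k := by omega
    have hin : ∀ x, InBox (loK L j c.1) (bondHiK L j c.1 c.2) x → InBox (sqLo L a ρ i.k 0) (sqHi L a Mc ρ i.k 0) x := fun x hx => by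
      have h := hsub x hx
      rw [hΩ, cubeFam_false_of_le L a Mc ρ hjk] at h
      exact (B8Ineq159FlatCubeMemberKernel.mem_cube_zero_iff L a Mc ρ i.k x).1 (cube_anti (Nat.zero_le _) hjk h)
    have hle : ∀ i', loK L j c.1 i' ≤ bondHiK L j c.1 c.2 i' := fun i' => by
      have hP : (1 : ℤ) ≤ (L : ℤ) ^ j := one_le_pow₀ (by exact_mod_cast hL1)
      simp only [loK, bondHiK]; split_ifs <;> linarith
    have h1 := hin (loK L j c.1) (fun i' => ⟨le_rfl, hle i'⟩)
    have h2 := hin (bondHiK L j c.1 c.2) (fun i' => ⟨hle i', le_rfl⟩)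
    refine hag.mono (fun i' => ?_) (fun i' => ?_)
    · linarith [(h1 i').1]
    · linarith [(h2 i').2]

end Cube

end Literature.MathematicalPhysics.QuantumFieldTheory.Balaban1983to89.B9Eq326DeltaALocalityZd

end
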